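import Mathlib
import HarnessLib
import Summits.ValiantsHypothesis.ValiantsHypothesis.Theses.MonotoneRestoration
import Literature.ModelTheory.FiniteModelTheory.CkEquiv
import Literature.ModelTheory.FiniteModelTheory.CountingWidth
import Literature.ModelTheory.FiniteModelTheory.SymmetricCircuitCountingWidthProofs
import Literature.Computability.AlgebraicComplexity.SymmetricThresholdTranslation
import Summits.ValiantsHypothesis.ValiantsHypothesis.Theorems.MonotoneRestorationMonotoneRestorationQPSymmetricLB
import Summits.ValiantsHypothesis.ValiantsHypothesis.Theorems.MonotoneRestorationMonotoneRestorationQPPermSupportCount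

/-!
# ValiantsHypothesis / MonotoneRestoration — `MonotoneRestorationQP`, line `Sketch`, stub F1

Support file for crux item `stmt-ValiantsHypothesis-15886`
(`Summit.ValiantsHypothesis.ValiantsHypothesis.Theses.MonotoneRestoration.MonotoneRestorationQP`),
line `Sketch`, stub `stub_fooling_of_qpSymmetric`: **quasi-polynomial square-symmetric circuits
fool `C^polylog`**, uniformly in the exponent. For every `c` there is `c'` (here `c' = c + 10`)
such that, for every `n`, a polynomial `p` on the `n × n` variable matrix computed by a
square-symmetric `LabelledArithCircuit` over `ℂ` with at most `2^{(log₂ n + c)^c}` gates takes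
the same value at the `0/1` adjacency matrices of any two `≡^{C^K}`-equivalent graphs,
`K = (log₂ n + c')^{c'}`. This is the per-`n`, polylog-scale twin of the asymptotic pipeline
`stub_symmetricLB_of_linearCountingWidth` (S4).

Proof (Dawar–Wilsenach 2025, §6 p. 17 and Thm 5.1, all ingredients PROVED in the tree). Put
`L = log₂ n`, `k = (L + c)^c + 2L + 3`.
* Large `n` (`n > 8`, `4(k+1) ≤ n`): let `v` be the value of `p` at the adjacency matrix of `X`
  and `S = {v}`. Theorem 5.1 per `n` (`LabelledArithCircuit.thresholdCircuit`) gives a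
  square-symmetric threshold circuit `Ψ` deciding `p(A) ∈ S` of orbit size
  `≤ |C| + n² + 1 ≤ 2^{(L+c)^c} + n² + 1`; its reduced rigidification `C'`
  (`exists_reduced_rigidification_supports`) has orbit size `≤ 2^{(L+c)^c} + 2n² + 1 ≤ 2^k ≤ C(n, k)`
  (`fooling_two_pow_bound`, `permSupportCount_two_pow_le_choose`), hence supports of size `≤ k`,
  hence (`eval_adjInput_eq_of_ckEquiv`) does not distinguish `≡^{C^{2k+2}}`-equivalent graphs:
  `p(Y) ∈ {v}`.
* Small `n` (`n ≤ 4k + 3`): `K ≥ n` pebbles decide isomorphism (`CkEquiv.nonempty_iso`), and the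
  value of a square-symmetric circuit is an isomorphism invariant (`symmetricLB_eval_perm_eq`).
* In both cases `K = (L + c + 10)^{c+10} ≥ 4k + 3` suffices (`fooling_index_le`).

No new definitions.
-/

-- `Summit.ValiantsHypothesis.ValiantsHypothesis.…` is the tree's mandated single-conjunct layout
-- (Sub = Summit), so the duplicated namespace component is intended.
set_option linter.dupNamespace false

namespace Summit.ValiantsHypothesis.ValiantsHypothesis.Theorems

open Literature.Computability.AlgebraicComplexity
open Literature.ModelTheory.FiniteModelTheory
open Literature.Computability.Complexity

/-- **The index bound**: `4 ((L + c)^c + 2L + 3) + 3 ≤ (L + c + 10)^{c + 10}` for all `L`, so the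
exponent `c' = c + 10` dominates both the pebble number `2k + 2` of the support argument and the
small orders `n ≤ 4k + 3`. [folklore] -/
theorem fooling_index_le (c L : ℕ) :
    4 * ((L + c) ^ c + 2 * L + 3) + 3 ≤ (L + (c + 10)) ^ (c + 10) := by
  set m : ℕ := L + (c + 10) with hm
  have hm10 : 10 ≤ m := by omega
  have hX : (L + c) ^ c ≤ m ^ c := Nat.pow_le_pow_left (by omega) c
  have hX1 : 1 ≤ m ^ c := Nat.one_le_pow _ _ (by omega)
  calc 4 * ((L + c) ^ c + 2 * L + 3) + 3 ≤ 4 * m ^ c + 8 * m * m ^ c := by nlinarith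
    _ = (4 + 8 * m) * m ^ c := by ring
    _ ≤ m ^ 2 * m ^ c := Nat.mul_le_mul_right _ (by nlinarith)
    _ = m ^ (c + 2) := by ring
    _ ≤ m ^ (c + 10) := Nat.pow_le_pow_right (by omega) (by omega)

/-- **The orbit bound fits under `2^k`**: with `L = log₂ n` one has `n < 2^{L+1}`, so
`2^{(L+c)^c} + 2n² + 1 ≤ 2^{(L+c)^c} + 2^{2L+3} ≤ 2^{(L+c)^c + 2L + 3}`. [folklore] -/
theorem fooling_two_pow_bound (c n : ℕ) :
    2 ^ ((Nat.log 2 n + c) ^ c) + 2 * n ^ 2 + 1 ≤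
      2 ^ ((Nat.log 2 n + c) ^ c + 2 * Nat.log 2 n + 3) := by
  set L : ℕ := Nat.log 2 n with hL
  have hn : n < 2 ^ (L + 1) := Nat.lt_pow_succ_log_self Nat.one_lt_two n
  have hn2 : n ^ 2 < 2 ^ (2 * L + 2) := by
    calc n ^ 2 < (2 ^ (L + 1)) ^ 2 := Nat.pow_lt_pow_left hn two_ne_zero
      _ = 2 ^ (2 * L + 2) := by ring
  have hB : 2 * n ^ 2 + 1 < 2 ^ (2 * L + 3) := by
    have h : 2 ^ (2 * L + 3) = 2 * 2 ^ (2 * L + 2) := by ring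
    omega
  have h1 : 0 < (L + c) ^ c := Nat.pow_pos_iff.2 (by omega)
  have hA2 : 2 ≤ 2 ^ ((L + c) ^ c) :=
    le_of_eq_of_le (pow_one 2).symm (Nat.pow_le_pow_right Nat.two_pos h1)
  have hB2 : 2 ≤ 2 ^ (2 * L + 3) :=
    le_of_eq_of_le (pow_one 2).symm (Nat.pow_le_pow_right Nat.two_pos (by omega))
  calc 2 ^ ((L + c) ^ c) + 2 * n ^ 2 + 1 ≤ 2 ^ ((L + c) ^ c) + 2 ^ (2 * L + 3) := by omega
    _ ≤ 2 ^ ((L + c) ^ c) * 2 ^ (2 * L + 3) := by nlinarith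
    _ = 2 ^ ((L + c) ^ c + 2 * L + 3) := by ring

/-- **The `0/1` adjacency matrix as a complex input**: the indicator of the edge set is the
Boolean adjacency input `adjInput X` read as `0/1 ∈ ℂ` (the form used by
`LabelledArithCircuit.thresholdCircuit_eval`). [folklore] -/
theorem fooling_indicator_eq_adjInput {n : ℕ} (X : SimpleGraph (Fin n)) [DecidableRel X.Adj] :
    Set.indicator {ij : Fin n × Fin n | X.Adj ij.1 ij.2} (1 : Fin n × Fin n → ℂ) =
      fun ij => if adjInput X ij = true then (1 : ℂ) else 0 := by
  funext ij
  by_cases h : X.Adj ij.1 ij.2 <;> simp [h]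

/-- **The value of a square-symmetric single-output circuit at an adjacency matrix is an
isomorphism invariant** (the computed polynomial is `Sym_n`-invariant,
`symmetricLB_eval_perm_eq`, and an isomorphism `e : X ≃g Y` carries the indicator of `E(Y)`
composed with `e × e` to the indicator of `E(X)`). [folklore] -/
theorem fooling_eval_eq_of_iso {n : ℕ} {G : Type}
    (C : LabelledArithCircuit ℂ (Fin n × Fin n) Unit G) (hC : C.IsSymmetric (Equiv.Perm (Fin n)))
    {X Y : SimpleGraph (Fin n)} (e : X ≃g Y) :
    MvPolynomial.eval (Set.indicator {ij : Fin n × Fin n | X.Adj ij.1 ij.2} 1)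
        (C.eval (C.output ())) =
      MvPolynomial.eval (Set.indicator {ij : Fin n × Fin n | Y.Adj ij.1 ij.2} 1)
        (C.eval (C.output ())) := by
  refine symmetricLB_eval_perm_eq C hC e.toEquiv _ _ fun ij => ?_
  by_cases h : X.Adj ij.1 ij.2
  · have h' : Y.Adj (e ij.1) (e ij.2) := e.map_adj_iff.2 h
    simp [h, h']
  · have h' : ¬ Y.Adj (e ij.1) (e ij.2) := fun h'' => h (e.map_adj_iff.1 h'')
    simp [h, h']

/-- **F1 — quasi-polynomial square-symmetric circuits fool `C^polylog`** (Dawar–Wilsenach 2025,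
§6 p. 17 with Thm 5.1, per `n` and uniformly in the exponent): for every `c` there is `c'` such
that a polynomial `p` on the `n × n` matrix computed by a square-symmetric circuit over `ℂ` with
at most `2^{(log₂ n + c)^c}` gates takes equal values at the adjacency matrices of any two
`≡^{C^{(log₂ n + c')^{c'}}}`-equivalent graphs on `Fin n`. Large `n`: Theorem 5.1
(`thresholdCircuit`, target set `{p(X)}`), reduced rigidification with the support theorem at
orbit size `≤ 2^k ≤ C(n, k)`, `k = (log₂ n + c)^c + 2 log₂ n + 3`, and
`eval_adjInput_eq_of_ckEquiv` with `2k + 2` pebbles; small `n ≤ 4k + 3`: enough pebbles decide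
isomorphism and the value is an isomorphism invariant. [cite: DawarWilsenach2025, §6 p. 17] -/
theorem stub_fooling_of_qpSymmetric (c : ℕ) : ∃ c' : ℕ, ∀ (n : ℕ)
    (p : MvPolynomial (Fin n × Fin n) ℂ),
    (∃ (G : Type) (_ : Fintype G) (C : LabelledArithCircuit ℂ (Fin n × Fin n) Unit G),
      C.IsSymmetric (Equiv.Perm (Fin n)) ∧ C.eval (C.output ()) = p ∧
      Fintype.card G ≤ 2 ^ ((Nat.log 2 n + c) ^ c)) →
    ∀ X Y : SimpleGraph (Fin n), CkEquiv ((Nat.log 2 n + c') ^ c') X Y →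
      MvPolynomial.eval (Set.indicator {ij : Fin n × Fin n | X.Adj ij.1 ij.2} 1) p =
        MvPolynomial.eval (Set.indicator {ij : Fin n × Fin n | Y.Adj ij.1 ij.2} 1) p := by
  refine ⟨c + 10, fun n p hp X Y hXY => ?_⟩
  obtain ⟨G, hG, C, hsym, heval, hcard⟩ := hp
  classical
  subst heval
  -- the scales: `L = log₂ n`, `k = (L + c)^c + 2L + 3`, `K = (L + c + 10)^{c+10} ≥ 4k + 3`
  set L : ℕ := Nat.log 2 n with hL
  set k : ℕ := (L + c) ^ c + 2 * L + 3 with hk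
  have hK : 4 * k + 3 ≤ (L + (c + 10)) ^ (c + 10) := fooling_index_le c L
  by_cases hgood : 8 < n ∧ 4 * (k + 1) ≤ n
  · obtain ⟨hn8, hkn⟩ := hgood
    -- (1) Theorem 5.1 per `n`: the symmetric threshold circuit deciding `p(A) = p(X)`
    set v : ℂ := MvPolynomial.eval (fun ij => if adjInput X ij = true then (1 : ℂ) else 0)
      (C.eval (C.output ())) with hv
    have hΨB := C.thresholdCircuit_isOver ({v} : Set ℂ)
    have hΨsym := C.thresholdCircuit_isSymmetricUnder ({v} : Set ℂ) hsym
    have hΨorb : (C.thresholdCircuit ({v} : Set ℂ)).orbitSize Set.univ ≤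
        2 ^ ((L + c) ^ c) + n ^ 2 + 1 := by
      have h := (C.orbitSize_le_size (Equiv.Perm (Fin n))).trans hcard
      exact (C.thresholdCircuit_orbitSize_le ({v} : Set ℂ) hsym).trans (by omega)
    -- (2) reduced rigidification with supports of size `≤ k`
    obtain ⟨C', hB', hsym', heval', horb', hsupp'⟩ :=
      exists_reduced_rigidification_supports (C.thresholdCircuit ({v} : Set ℂ)) hΨB hΨsym
    have horbC' : C'.orbitSize Set.univ ≤ n.choose k :=
      calc C'.orbitSize Set.univ ≤ 2 ^ ((L + c) ^ c) + 2 * n ^ 2 + 1 := by omega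
        _ ≤ 2 ^ k := fooling_two_pow_bound c n
        _ ≤ n.choose k := permSupportCount_two_pow_le_choose k n (by omega)
    have hsupp := hsupp' hn8 k (by omega) ((Nat.le_div_iff_mul_le (by norm_num)).2 (by omega))
      horbC'
    -- (3) supports of size `k` fool `≡^{C^{2k+2}}`
    have hXY' : CkEquiv (2 * k + 2) X Y := hXY.mono (by omega)
    have hfool : C'.eval (adjInput X) = C'.eval (adjInput Y) :=
      eval_adjInput_eq_of_ckEquiv hB' hsym' hsupp hXY'
    -- (4) read off: `p(X) ∈ {v}`, hence `p(Y) ∈ {v}`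
    have hX : (C.thresholdCircuit ({v} : Set ℂ)).eval (adjInput X) = true :=
      (C.thresholdCircuit_eval ({v} : Set ℂ) (adjInput X)).2 (Set.mem_singleton v)
    have hY : (C.thresholdCircuit ({v} : Set ℂ)).eval (adjInput Y) = true := by
      rw [← heval', ← hfool, heval']
      exact hX
    have hYv := (C.thresholdCircuit_eval ({v} : Set ℂ) (adjInput Y)).1 hY
    rw [Set.mem_singleton_iff] at hYv
    rw [fooling_indicator_eq_adjInput X, fooling_indicator_eq_adjInput Y]
    exact hYv.symm
  · -- small `n ≤ 4k + 3 ≤ K`: enough pebbles decide isomorphism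
    have hn : n ≤ 4 * k + 3 := by omega
    obtain ⟨e⟩ := hXY.nonempty_iso (by omega) (by rw [Fintype.card_fin]; omega)
    exact fooling_eval_eq_of_iso C hsym e

end Summit.ValiantsHypothesis.ValiantsHypothesis.Theorems
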